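import Summits.AtomisticToContinuum.FouriersLaw.Theses.CageBudgetFekete
import Summits.AtomisticToContinuum.FouriersLaw.Theses.HoelderEscapeProfile
import Summits.AtomisticToContinuum.FouriersLaw.Theorems.HoelderEscapeProfileFibreCalculus
import Summits.AtomisticToContinuum.FouriersLaw.Theorems.CageBudgetFeketeUnboundedHeatVarianceAbelSandwichTransfer
import HarnessLib

/-!
# Stub `stub_relativeNegativeSpread_of_abelEnergyPositivity` of line `Sketch` — edge AbelDEP ⟹ P
(crux `CageBudgetFekete.UnboundedHeatVariance`, item stmt-AtomisticToContinuum-15771; `--supports` file)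

WHAT. The registered edge stub of the skeleton `Cruxes/UnboundedHeatVariance/Lines/Sketch.lean` recording the
cleanest sufficient condition for the line's open sign stub P (`stub_relativeNegativeSpread`): in the crux's
arena, ABEL-AVERAGED DYNAMICAL ENERGY POSITIVITY of the energy profile,
`S̄_ν(x) = ν∫₀^∞ e^{-νt} S(x,t) dt ≥ 0` for all sites `x` and all small `ν`, implies the relative negative
spread `N_ν = Σ_x x²(S(x,0) − S̄_ν(x))⁺ ≤ θ·Σ_x x²(S̄_ν(x) − S(x,0))⁺ + K` with `θ = 0 < 1` and
`K = Σ_x (1 + x²)|S(x,0)|`.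

HOW. Termwise, for `S̄_ν(x) ≥ 0`: `x²·max(S(x,0) − S̄_ν(x), 0) ≤ x²·max(S(x,0), 0) ≤ (1 + x²)|S(x,0)|`; the
twelve-clause fibre calculus `Theorems.FibreCalculusSketch.fibreCalculus_proof` (clauses 4, 5) supplies the
weighted summabilities `Σ(1+x²)|S̄_ν| < ∞`, `Σ(1+x²)|S(·,0)| < ∞`, so both sides are summable (landed
`Sketch.summable_sq_mul_posPart_of_weighted`, `Sketch.weighted_summable_sub`) and `Summable.tsum_le_tsum`
compares the sums.

No definitions; two real-analysis helper lemmas on weighted-summable sequences `ℤ → ℝ`, then the stub.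
prover-line-stmt-AtomisticToContinuum-15771-c1-0, 2026-08-17.
-/

noncomputable section

namespace Summit.AtomisticToContinuum.FouriersLaw.Theorems.UnboundedHeatVariance.Sketch

open MeasureTheory Set Filter Topology
open Literature.MathematicalPhysics.KineticTheory.HeatConduction
open Summit.AtomisticToContinuum.FouriersLaw.Theses

/-! ### 1. The termwise bound and the comparison of sums -/

/-- For `0 ≤ b`: `x²·max(a − b, 0) ≤ (1 + x²)|a|`. [folklore] -/
theorem sq_mul_posPart_sub_le_weight_mul_abs {a b : ℝ} (hb : 0 ≤ b) (x : ℤ) :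
    (x : ℝ) ^ 2 * max (a - b) 0 ≤ (1 + (x : ℝ) ^ 2) * |a| := by
  have h1 : max (a - b) 0 ≤ |a| := max_le (by linarith [le_abs_self a]) (abs_nonneg _)
  have h2 : 0 ≤ max (a - b) 0 := le_max_right _ _
  nlinarith [sq_nonneg (x : ℝ), abs_nonneg a]

/-- **Negative spread under positivity.** For weighted-summable `a, b : ℤ → ℝ` with `b ≥ 0` pointwise, the
negative second moment of the displacement `b − a` is capped by the weighted norm of `a`:
`Σ x²(a − b)⁺ ≤ Σ (1 + x²)|a|`. [folklore] -/
theorem negSpread_le_weighted_of_nonneg {a b : ℤ → ℝ}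
    (ha : Summable (fun x : ℤ => (1 + (x : ℝ) ^ 2) * |a x|))
    (hb : Summable (fun x : ℤ => (1 + (x : ℝ) ^ 2) * |b x|))
    (hpos : ∀ x : ℤ, 0 ≤ b x) :
    ∑' x : ℤ, (x : ℝ) ^ 2 * max (a x - b x) 0 ≤ ∑' x : ℤ, (1 + (x : ℝ) ^ 2) * |a x| :=
  Summable.tsum_le_tsum (fun x => sq_mul_posPart_sub_le_weight_mul_abs (hpos x) x)
    (summable_sq_mul_posPart_of_weighted (weighted_summable_sub ha hb)) ha

/-! ### 2. The stub -/

/-- **E4 — `stub_relativeNegativeSpread_of_abelEnergyPositivity` (registered signature, verbatim): Abel-averaged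
dynamical energy positivity implies the relative negative spread P.** In the arena of
`CageBudgetFekete.UnboundedHeatVariance`, if `S̄_ν(x) ≥ 0` for all `x` and all `0 < ν < ν₀`, then with `θ = 0`,
`K = Σ_x (1 + x²)|S(x,0)|` and the same `ν₀`:
`Σ_x x²(S(x,0) − S̄_ν(x))⁺ ≤ θ·Σ_x x²(S̄_ν(x) − S(x,0))⁺ + K` for `0 < ν < ν₀`
(fibre calculus `FibreCalculusSketch.fibreCalculus_proof`, clauses 4–5, and `negSpread_le_weighted_of_nonneg`).
[folklore] -/
theorem stub_relativeNegativeSpread_of_abelEnergyPositivity :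
    ∀ ω₂ lam β γ : ℝ, 0 < ω₂ → 0 < lam → 0 < β → ∀ T : ℝ, 0 < T → ∀ μ : MeasureTheory.Measure Literature.MathematicalPhysics.KineticTheory.HeatConduction.ChainConfig, (Literature.MathematicalPhysics.KineticTheory.HeatConduction.pinnedChain ω₂ lam β γ).IsChainGibbsMeasure T μ → Literature.MathematicalPhysics.KineticTheory.HeatConduction.IsShiftInvariant μ → μ.map (fun σ : Literature.MathematicalPhysics.KineticTheory.HeatConduction.ChainConfig => fun x : ℤ => ((σ x).1, -(σ x).2)) = μ → ∀ D : Literature.MathematicalPhysics.KineticTheory.HeatConduction.InfiniteChainDynamics (Literature.MathematicalPhysics.KineticTheory.HeatConduction.pinnedChain ω₂ lam β γ), D.PreservesMeasure μ → (∀ t : ℝ, ∀ᵐ σ ∂μ, D.flow t (Literature.MathematicalPhysics.KineticTheory.HeatConduction.shift σ) = Literature.MathematicalPhysics.KineticTheory.HeatConduction.shift (D.flow t σ)) → (∀ t : ℝ, D.HasAbsConvergentCorrelation μ t) → Continuous (fun t : ℝ => D.currentCorrelation μ t) → ∀ h : Literature.MathematicalPhysics.KineticTheory.HeatConduction.ChainConfig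 → ℤ → ℝ, h = (fun (σ : Literature.MathematicalPhysics.KineticTheory.HeatConduction.ChainConfig) (x : ℤ) => (σ x).2 ^ 2 / 2 + (Literature.MathematicalPhysics.KineticTheory.HeatConduction.pinnedChain ω₂ lam β γ).U (σ x).1 + ((Literature.MathematicalPhysics.KineticTheory.HeatConduction.pinnedChain ω₂ lam β γ).V ((σ (x + 1)).1 - (σ x).1) + (Literature.MathematicalPhysics.KineticTheory.HeatConduction.pinnedChain ω₂ lam β γ).V ((σ x).1 - (σ (x - 1)).1)) / 2) → ∀ S : ℤ → ℝ → ℝ, S = (fun (x : ℤ) (t : ℝ) => ∫ σ, (h σ 0 - ∫ σ', h σ' 0 ∂μ) * (h (D.flow t σ) x - ∫ σ', h σ' 0 ∂μ) ∂μ) → ∀ Sb : ℝ → ℤ → ℝ, Sb = (fun (ν : ℝ) (x : ℤ) => ν * ∫ t in Set.Ioi (0:ℝ), Real.exp (-(ν * t)) * S x t) → (∃ ν₀ : ℝ, 0 < ν₀ ∧ ∀ ν : ℝ, 0 < ν → ν < ν₀ → ∀ x : ℤ, 0 ≤ Sb ν x) → ∃ θ K ν₀ : ℝ, θ < 1 ∧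 0 < ν₀ ∧ ∀ ν : ℝ, 0 < ν → ν < ν₀ → ∑' x : ℤ, (x : ℝ) ^ 2 * max (S x 0 - Sb ν x) 0 ≤ θ * (∑' x : ℤ, (x : ℝ) ^ 2 * max (Sb ν x - S x 0) 0) + K := by
  intro ω₂ lam β γ hω hl hβ T hT μ hG hSI hRefl D hP hShift _ _ h hh S hS Sb hSb hDEP
  obtain ⟨ν₀, hν₀, hpos⟩ := hDEP
  obtain ⟨-, -, -, h4, h5, -, -, -, -, -, -, -⟩ :=
    Summit.AtomisticToContinuum.FouriersLaw.Theorems.FibreCalculusSketch.fibreCalculus_proof ω₂ lam β γ hω hl hβ T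
      hT μ hG hSI hRefl D hP hShift h hh S hS Sb hSb _ rfl _ rfl _ rfl _ rfl
  refine ⟨0, ∑' x : ℤ, (1 + (x : ℝ) ^ 2) * |S x 0|, ν₀, zero_lt_one, hν₀, fun ν hν hνν₀ => ?_⟩
  rw [zero_mul, zero_add]
  exact negSpread_le_weighted_of_nonneg h5 (h4 ν hν) (hpos ν hν hνν₀)

end Summit.AtomisticToContinuum.FouriersLaw.Theorems.UnboundedHeatVariance.Sketch

end
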